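import Summits.BirchSwinnertonDyer.BirchSwinnertonDyer.Theorems.SignedBaseChangeK2RAssembly
import Summits.BirchSwinnertonDyer.BirchSwinnertonDyer.Theorems.SignedLowerHalvesKobayashiMainConjectureSmallImageIrrOverCoprimeQuadratic
import HarnessLib

/-!
# Route `SignedLowerHalves`, crux `KobayashiMainConjectureSmallImage` (item stmt-BirchSwinnertonDyer-19002):
# the two INPUTS of `SignedBaseChange`'s signed two-variable descent K2R⁗ — (S1) `μ(G⁻) = μ(G'⁻) = 0` and
# (S3) the four-curve signed product divisibility — WITHOUT surjectivity of `ρ̄_{E,p}` (cell `bsd-ssimc`,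
# seat `bsd-line-slh-p3` gen 5, line `birth`; THEOREMS ONLY, route-independent; helper file `--supports` item 4)

PARTITION (cell bsd-ssimc): X7 (A7) × item 4's small-image domain (and in fact every X7 pair at `p ≥ 5`:
no image hypothesis below). Part 1 of 2 of the small-image twin of K2R⁗ (part 2:
`…SmallImageAcnsDescent.lean`, the descent itself); closes none; crux 4 OPEN. BSD is not proved by any of
this.

The sibling route's K2R⁗ inputs `…K2RMuZero.stub_muZero_of_prop422GreenbergAnyRoot` (S1) and
`…K2RTransferDescent.productLowerDivisibility_of_package` (S3) carry the binder `Surj W p` and use it ONLY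
for (irr_K) of `W`, `W'` over the auxiliary quadratic field `K` resp. for the absolute irreducibility of every
framing of `W'_K[p]`. Both image clauses hold with NO image hypothesis at a good supersingular odd `p` when
`(N, d_K) = 1` and `p` splits in `K` (Serre Prop. 12 + Matar–Nekovář 2019 Prop. 5.26 (2)(3), tree-proved;
companion `…SmallImageIrrOverCoprimeQuadratic.lean`, p619183). This file re-proves (S1) and (S3) VERBATIM with
the binder `Surj W p →` DELETED (`muZero_of_prop422GreenbergAnyRoot_noSurj`,
`productLowerDivisibility_of_package_noSurj`; the proofs are the tree's with the two clauses re-sourced), after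
the `Surj`-free bookkeeping of the auxiliary twists (§1, `auxiliaryCurves_noSurj`: good supersingular reduction
with `a_p = 0` of `W^{(D_K)}, W^{(d)}, W^{(dD_K)}`). HONEST SCOPE: CONDITIONAL on BCS 2025 Prop. 4.2.2 by name
and on the PRE binder `props118_27_519_…_PRE`; nothing of them is asserted.

References: [BurungaleSkinnerTianWan2024] arXiv:2409.01350v2 §2.3, Props. 1.18, 2.7, 5.19; [BurungaleCastellaSkinner2025]
Prop. 4.2.2; [MatarNekovar2019] Prop. 5.26 (2)(3); [Kobayashi2003] Thm. 3.2, (3.4)–(3.6); [SilvermanAEC2009] VII.5, X.5.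
-/

set_option autoImplicit false
-- justification: the layout's summit-side namespace for a single-conjunct summit (Sub = Summit) repeats the
-- component `BirchSwinnertonDyer`; helper files live under `Summit.<S>.<Sub>.Theorems`.
set_option linter.dupNamespace false

noncomputable section

open scoped Classical MatrixGroups ModularForm

open CongruenceSubgroup WeierstrassCurve NumberField IsDedekindDomain Field
  Literature.NumberTheory.GaloisRepresentations Literature.NumberTheory.EllipticCurves
  Literature.NumberTheory.EllipticCurves.ModularForms Literature.NumberTheory.EllipticCurves.Rank1Residual
  Literature.NumberTheory.EllipticCurves.BurungaleSkinnerTianWan2024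
  Literature.NumberTheory.EllipticCurves.BurungaleCastellaSkinner2025
  Literature.NumberTheory.EllipticCurves.GreenbergVatsal2000 Literature.NumberTheory.EllipticCurves.UnrSeries₂
  Literature.NumberTheory.EllipticCurves.Kobayashi2003 ZpExtension
  Summit.BirchSwinnertonDyer.Rank1Residual.Supersingular
  Summit.BirchSwinnertonDyer.BirchSwinnertonDyer.Theorems.SignedBaseChangeEisensteinSqueeze

namespace Summit.BirchSwinnertonDyer.BirchSwinnertonDyer.Theorems.SmallImageTwoVariableInputsNoSurj

/-! ## §1. The auxiliary twists WITHOUT `Surj` -/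

/-- **A twist by a square-free `d` prime to the odd prime `p` stays good supersingular** (`C • V' = V^{(d)}`,
`V` good at `p` with `a_p(V) = 0` ⇒ the same for `V'`; `a_p(V') = (d/p)·a_p(V)`) — the tree's
`…SignedBaseChangeAuxiliaryCurves.goodSS_surj_of_smul_eq_quadraticTwist` with the `Surj` clause dropped.
[cite: SilvermanAEC2009, VII.5 Prop. 5.1(a) and X.5 Cor. 5.4] -/
theorem goodSS_of_smul_eq_quadraticTwist_noSurj (V V' : WeierstrassCurve ℚ) [V.IsElliptic] [V.IsGloballyMinimal]
    [V'.IsElliptic] [V'.IsGloballyMinimal] (p : ℕ) [Fact p.Prime] (hp2 : p ≠ 2) {d : ℤ} (hd : Squarefree d)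
    (hpd : ¬ (p : ℤ) ∣ d) {C : VariableChange ℚ} (hC : C • V' = V.quadraticTwist (d : ℚ))
    (hgood : V.HasGoodReductionAtPrime p) (hap : V.frobeniusTrace p = 0) :
    V'.HasGoodReductionAtPrime p ∧ V'.frobeniusTrace p = 0 := by
  have hpP : p.Prime := Fact.out
  have hp2d : ¬ (p : ℤ) ∣ 2 * d := by
    intro h
    rcases (Nat.prime_iff_prime_int.mp hpP).dvd_or_dvd h with h2 | hd'
    · have : p ∣ 2 := by exact_mod_cast h2
      exact hp2 ((Nat.prime_dvd_prime_iff_eq hpP Nat.prime_two).mp this)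
    · exact hpd hd'
  refine ⟨hasGoodReductionAtPrime_of_smul_eq_quadraticTwist V V' p hC hp2d hgood, ?_⟩
  rw [frobeniusTrace_of_smul_eq_quadraticTwist V V' p hd hC hp2d hgood, hap, mul_zero]

/-- **A twist by the discriminant of a quadratic field `K` with `p ∤ disc K` (odd `p`) stays good
supersingular** — the tree's `goodSS_surj_of_smul_eq_quadraticTwist_discr` with the `Surj` clause dropped
(`disc K` is square-free or `4m`, `m` square-free; `V^{(4m)} ≅ V^{(m)}`).
[cite: Knapp1993, Prop. 12.10] [cite: NeukirchANT1999, Ch. III Cor. (2.12)] -/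
theorem goodSS_of_smul_eq_quadraticTwist_discr_noSurj {K : Type*} [Field K] [NumberField K]
    (h2 : Module.finrank ℚ K = 2) (V V' : WeierstrassCurve ℚ) [V.IsElliptic] [V.IsGloballyMinimal]
    [V'.IsElliptic] [V'.IsGloballyMinimal] (p : ℕ) [Fact p.Prime] (hp2 : p ≠ 2)
    (hpD : ¬ (p : ℤ) ∣ NumberField.discr K) {C : VariableChange ℚ}
    (hC : C • V' = V.quadraticTwist (NumberField.discr K : ℚ))
    (hgood : V.HasGoodReductionAtPrime p) (hap : V.frobeniusTrace p = 0) :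
    V'.HasGoodReductionAtPrime p ∧ V'.frobeniusTrace p = 0 := by
  rcases Literature.NumberTheory.QuadraticFields.Quadratic.isFundamentalDiscriminant_discr h2 with
    ⟨-, hsq, -⟩ | ⟨h4, -, hsq⟩
  · exact goodSS_of_smul_eq_quadraticTwist_noSurj V V' p hp2 hsq hpD hC hgood hap
  · set m : ℤ := NumberField.discr K / 4 with hm
    have hdm : NumberField.discr K = m * 2 ^ 2 := by
      rw [hm]; have := Int.ediv_mul_cancel h4; omega
    obtain ⟨C₂, hC₂⟩ := V.exists_variableChange_quadraticTwist_mul_sq (m : ℚ) 2 two_ne_zero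
    have hcast : ((NumberField.discr K : ℤ) : ℚ) = (m : ℚ) * 2 ^ 2 := by rw [hdm]; push_cast; ring
    have hC' : (C₂⁻¹ * C) • V' = V.quadraticTwist (m : ℚ) := by
      rw [mul_smul, hC, hcast, ← hC₂, inv_smul_smul]
    have hpm : ¬ (p : ℤ) ∣ m := fun h ↦ hpD (hdm ▸ dvd_mul_of_dvd_left h _)
    exact goodSS_of_smul_eq_quadraticTwist_noSurj V V' p hp2 hsq hpm hC' hgood hap

/-- **The auxiliary curves WITHOUT `Surj`** (the tree's `…SignedBaseChangeAuxiliaryCurves.stub_auxiliaryCurves`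
with the `Surj` clauses dropped): for an X7 pair `(W, p)` with `p ≥ 5`, `K` imaginary quadratic with `p` split
and an admissible twist `W'` of `W` by a square-free `d`, there are globally minimal models `W₂ ≃ E^{(disc K)}`,
`W₄ ≃ (E^{(d)})^{(disc K)}`, and each of `W₂, W', W₄` has good reduction at `p` with `a_p = 0` — the hypotheses
of Kobayashi Thm. 1.2 and of the RATIONAL form of Thm. 4.1 for the four `ℚ`-curves of the descent.
[cite: SilvermanAEC2009, VII.5 Prop. 5.1(a), VIII.8 and X.5 Cor. 5.4] [cite: Knapp1993, Prop. 12.10] -/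
theorem auxiliaryCurves_noSurj : ∀ (W : WeierstrassCurve ℚ) [W.IsElliptic] [W.IsGloballyMinimal] (p : ℕ)
    [Fact p.Prime], 5 ≤ p → ClassX7 W p →
    ∀ (K : Type) [Field K] [NumberField K] (N : ℕ) (d : ℤ) (W' : WeierstrassCurve ℚ) [W'.IsElliptic]
      [W'.IsGloballyMinimal] (C : WeierstrassCurve.VariableChange ℚ),
    Squarefree d →
    (∀ q : ℕ, q.Prime → RamifiedInQuadratic d q → q ≠ p ∧ ¬ q ∣ N ∧ ¬ (q : ℤ) ∣ NumberField.discr K) →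
    C • W' = W.quadraticTwist (d : ℚ) →
    IsImaginaryQuadratic K →
    ((Ideal.span {(p : ℤ)}).primesOver (𝓞 K)).ncard = 2 →
    ∃ (W₂ W₄ : WeierstrassCurve ℚ) (_ : W₂.IsElliptic) (_ : W₂.IsGloballyMinimal) (_ : W₄.IsElliptic)
      (_ : W₄.IsGloballyMinimal) (C₂ C₄ : WeierstrassCurve.VariableChange ℚ),
      C₂ • W₂ = W.quadraticTwist (NumberField.discr K : ℚ) ∧ C₄ • W₄ = W'.quadraticTwist (NumberField.discr K : ℚ) ∧
      (W₂.HasGoodReductionAtPrime p ∧ W₂.frobeniusTrace p = 0) ∧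
      (W'.HasGoodReductionAtPrime p ∧ W'.frobeniusTrace p = 0) ∧
      (W₄.HasGoodReductionAtPrime p ∧ W₄.frobeniusTrace p = 0) := by
  intro W _ _ p _ hp5 hX K _ _ N d W' _ _ C hd hram hC hK hsplit
  have hpP : p.Prime := Fact.out
  have hp2 : p ≠ 2 := by omega
  have hgood : W.HasGoodReductionAtPrime p := hX.1.1
  have hap : W.frobeniusTrace p = 0 := ClassX7.frobeniusTrace_eq_zero_of_five_le W p hp5 hX
  have hpd : ¬ (p : ℤ) ∣ d := fun h ↦ (hram p hpP (Or.inl h)).1 rfl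
  have hpD : ¬ (p : ℤ) ∣ NumberField.discr K := not_dvd_discr_of_ncard_primesOver_eq_two hK.1 hpP hsplit
  have hD0 : (NumberField.discr K : ℚ) ≠ 0 := by exact_mod_cast NumberField.discr_ne_zero K
  obtain ⟨hgood', hap'⟩ := goodSS_of_smul_eq_quadraticTwist_noSurj W W' p hp2 hd hpd hC hgood hap
  obtain ⟨W₂, _, _, C₂, hC₂⟩ := exists_isGloballyMinimal_smul_eq_quadraticTwist W hD0
  obtain ⟨W₄, _, _, C₄, hC₄⟩ := exists_isGloballyMinimal_smul_eq_quadraticTwist W' hD0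
  exact ⟨W₂, W₄, inferInstance, inferInstance, inferInstance, inferInstance, C₂, C₄, hC₂, hC₄,
    goodSS_of_smul_eq_quadraticTwist_discr_noSurj hK.1 W W₂ p hp2 hpD hC₂ hgood hap, ⟨hgood', hap'⟩,
    goodSS_of_smul_eq_quadraticTwist_discr_noSurj hK.1 W' W₄ p hp2 hpD hC₄ hgood' hap'⟩

/-! ## §2. (S1) `μ(G⁻) = μ(G'⁻) = 0` from BCS Prop. 4.2.2 BY NAME — WITHOUT `Surj` -/

/-- **(S1) of K2R⁗ without `Surj`.** VERBATIM the tree's `…K2RMuZero.stub_muZero_of_prop422GreenbergAnyRoot`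
(BCS 2025 Prop. 4.2.2, Gr-half at good reduction, granted BY NAME ⇒ for the K1′/K2R‴ package data and any
genuine common Katz frame, `μ(G⁻) = μ(G'⁻) = 0`) with the binder `Surj W p →` DELETED: the only place it was
used — (irr_K) for `W`, `W'` — is re-sourced from Serre Prop. 12 + Matar–Nekovář Prop. 5.26 (2)
(`SmallImageIrrK.hasIrreducibleModPGaloisRep_baseChange_of_goodSS_of_isCoprime`; `(N, D_K) = 1` is clause c15,
`(N', D_K) = 1` the tree's twist lemma). CONDITIONAL on that one refereed fact; nothing else.
[cite: BurungaleCastellaSkinner2025, Prop. 4.2.2 and its proof (§4.2, p. 9 of arXiv:2405.00270v2)]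
[cite: MatarNekovar2019, Prop. 5.26 (2) (p. 492)] [cite: Serre1972, §1.11 Prop. 12] -/
theorem muZero_of_prop422GreenbergAnyRoot_noSurj (h : prop422_greenbergAnyRoot_hasUnitContent_minus) :
    ∀ (W : WeierstrassCurve ℚ) [W.IsElliptic] [W.IsGloballyMinimal] (p : ℕ) [Fact p.Prime], 5 ≤ p →
    ClassX7 W p →
    ∀ (K : Type) [Field K] [NumberField K] (ι : PadicAlgCl p ≃+* ℂ) (v vbar : IsDedekindDomain.HeightOneSpectrum (NumberField.RingOfIntegers K)) (κ₁ κ₂ : Literature.NumberTheory.EllipticCurves.ZpExtension K p) (γ₁ γ₂ : Field.absoluteGaloisGroup K) [Fact (Literature.NumberTheory.EllipticCurves.ZpExtension.IsTopGeneratorPair κ₁ κ₂ γ₁ γ₂)] [NeZero (NumberField.discr K).natAbs] (N : ℕ) [NeZero N] (f : CuspForm (CongruenceSubgroup.Gamma0 N) 2) (d : ℤ) (W' : WeierstrassCurve ℚ) [W'.IsElliptic] [W'.IsGloballyMinimal] (C : WeierstrassCurve.VariableChange ℚ) (N' : ℕ) [NeZero N'] (f' : CuspForm (CongruenceSubgroup.Gamma0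 N') 2),
    (Literature.NumberTheory.EllipticCurves.ModularForms.IsNewformOf W f) →
    ((N : ℤ) = W.conductorNorm ℤ) →
    (Literature.NumberTheory.EllipticCurves.ModularForms.IsNewformOf W' f') →
    ((N' : ℤ) = W'.conductorNorm ℤ) →
    (Squarefree d) →
    (1 < d) →
    (∀ q : ℕ, q.Prime → Literature.NumberTheory.EllipticCurves.BurungaleSkinnerTianWan2024.RamifiedInQuadratic d q → q ≠ p ∧ ¬ q ∣ N ∧ ¬ (q : ℤ) ∣ NumberField.discr K) →
    (C • W' = W.quadraticTwist (d : ℚ)) →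
    (Literature.NumberTheory.EllipticCurves.IsImaginaryQuadratic K) →
    (((Ideal.span {(p : ℤ)}).primesOver (NumberField.RingOfIntegers K)).ncard = 2) →
    (((p : ℕ) : NumberField.RingOfIntegers K) ∈ v.asIdeal) →
    (((p : ℕ) : NumberField.RingOfIntegers K) ∈ vbar.asIdeal) →
    (vbar ≠ v) →
    (∀ (w : NumberField.InfinitePlace K) (k : NumberField.RingOfIntegers K), k ∈ v.asIdeal ↔ ‖ι.symm (w.embedding (k : K))‖ < 1) →
    (IsCoprime (N : ℤ) (NumberField.discr K)) →
    (∀ ℓ : ℕ, ℓ.Prime → ℓ ∣ N → ((Ideal.span {(ℓ : ℤ)}).primesOver (NumberField.RingOfIntegers K)).ncard = 2) →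
    (∀ ℓ : ℕ, ℓ.Prime → (ℓ : ℤ) ∣ d → ((Ideal.span {(ℓ : ℤ)}).primesOver (NumberField.RingOfIntegers K)).ncard = 2) →
    (((Ideal.span {(2 : ℤ)}).primesOver (NumberField.RingOfIntegers K)).ncard = 2) →
    (∀ ρ : Literature.NumberTheory.GaloisRepresentations.ModPGaloisRep K (ZMod p) 2, (W.baseChange K).IsTorsionGaloisRep p ρ → Literature.NumberTheory.GaloisRepresentations.FramedRep.IsAbsolutelyIrreducible ρ) →
    (κ₁.IsCyclotomic) →
    (κ₂.IsAnticyclotomic) →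
    ∀ (Ω δ : ℂ) (Ωp : (Literature.NumberTheory.EllipticCurves.unrIntegers p)ˣ)
      (LK G G' : PowerSeries (PowerSeries (PadicComplexInt p))),
      Ω ≠ 0 → (δ ^ 2 = (NumberField.discr K : ℂ) ∨ δ ^ 2 = -(NumberField.discr K : ℂ)) →
      Literature.NumberTheory.EllipticCurves.IsKatzMeasure₂ ι v vbar ∅ κ₁ κ₂ γ₁⁻¹ γ₂⁻¹ 1 Ω δ
        ((Ωp : Literature.NumberTheory.EllipticCurves.unrIntegers p) : PadicComplex p) LK →
      Literature.NumberTheory.EllipticCurves.IsGreenbergLFunctionAnyRoot₂ ι v vbar κ₁ κ₂ γ₁⁻¹ γ₂⁻¹ f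
        (NumberField.discr K).natAbs (NumberField.classNumber K) LK G →
      Literature.NumberTheory.EllipticCurves.IsGreenbergLFunctionAnyRoot₂ ι v vbar κ₁ κ₂ γ₁⁻¹ γ₂⁻¹ f'
        (NumberField.discr K).natAbs (NumberField.classNumber K) LK G' →
      HasUnitContent (minus G) ∧ HasUnitContent (minus G') := by
  intro W _ _ p _ hp5 hX K _ _ ι v vbar κ₁ κ₂ γ₁ γ₂ hpair _ N _ f d W' _ _ C N' _ f'
    c1 c2 c3 c4 c5 c6 c7 c8 c9 c10 c11 c12 c13 c14 c15 c16 c17 c18 c19 c20 c21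
    Ω δ Ωp LK G G' hΩ hδ hLK hG hG'
  have hpP : p.Prime := Fact.out
  have hp2 : p ≠ 2 := by omega
  have hp : 2 < p := by omega
  have hgood : W.HasGoodReductionAtPrime p := hX.1.1
  have hap : W.frobeniusTrace p = 0 :=
    Summit.BirchSwinnertonDyer.Rank1Residual.Supersingular.ClassX7.frobeniusTrace_eq_zero_of_five_le W p hp5 hX
  have hpd : ¬ (p : ℤ) ∣ d := fun h ↦ (c7 p hpP (Or.inl h)).1 rfl
  -- the twist: good supersingular at `p` (NO image hypothesis)
  obtain ⟨hgood', hap'⟩ := goodSS_of_smul_eq_quadraticTwist_noSurj W W' p hp2 c5 hpd c8 hgood hap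
  -- (Heeg) for `N` and `N'`; `(N', D_K) = 1`
  have hHeeg' : SatisfiesHeegnerHypothesis N' K :=
    Summit.BirchSwinnertonDyer.BirchSwinnertonDyer.Theorems.SignedBaseChangeK2RMuZero.satisfiesHeegnerHypothesis_twist
      W W' c8 c2 c4 K c16 c17 c18
  have hND' : IsCoprime (N' : ℤ) (NumberField.discr K) := by
    have hN'n : N' = W'.conductorNorm ℤ := by exact_mod_cast c4
    rw [Int.isCoprime_iff_gcd_eq_one, Int.gcd_eq_natAbs, Int.natAbs_natCast]
    refine Nat.coprime_of_dvd fun q hq hqN' hqD ↦ ?_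
    -- `q ∣ N'` splits in `K` (Heegner for `N'`), while `q ∣ D_K` ramifies: `(D_K / q)`-count mismatch at `q`
    have hsplit : ((Ideal.span {(q : ℤ)}).primesOver (NumberField.RingOfIntegers K)).ncard = 2 := hHeeg' q hq hqN'
    have hqD' : (q : ℤ) ∣ NumberField.discr K := Int.ofNat_dvd_left.mpr hqD
    rcases eq_or_ne q 2 with rfl | hq2
    · have h8 : NumberField.discr K % 8 = 1 :=
        (Literature.NumberTheory.QuadraticFields.Quadratic.ncard_primesOver_two_eq_two_iff c9.1).mp c18
      omega
    · haveI : Fact q.Prime := ⟨hq⟩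
      have hj := (Literature.NumberTheory.QuadraticFields.Quadratic.ncard_primesOver_eq_two_iff_jacobiSym c9.1 hq hq2).mp hsplit
      rw [jacobiSym.mod_left, Int.emod_eq_zero_of_dvd hqD', jacobiSym.zero_left hq.one_lt] at hj
      exact absurd hj (by decide)
  -- (disc) from «2 splits in K»
  obtain ⟨hodd, hne3⟩ :=
    Summit.BirchSwinnertonDyer.BirchSwinnertonDyer.Theorems.SignedBaseChangeK2RMuZero.odd_discr_and_discr_ne_neg_three_of_two_split
      K c9.1 c18
  -- (irr_K) for `W` and for `W'`: Serre Prop. 12 + Matar–Nekovář Prop. 5.26 (2) — NO `Surj`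
  have hirr : (W.baseChange K).HasIrreducibleModPGaloisRep p :=
    SmallImageIrrK.hasIrreducibleModPGaloisRep_baseChange_of_goodSS_of_isCoprime W p hp2 hgood
      (hap ▸ dvd_zero _) K c9.1 c2 c15
  have hirr' : (W'.baseChange K).HasIrreducibleModPGaloisRep p :=
    SmallImageIrrK.hasIrreducibleModPGaloisRep_baseChange_of_goodSS_of_isCoprime W' p hp2 hgood'
      (hap' ▸ dvd_zero _) K c9.1 c4 hND'
  exact ⟨h ι W K v vbar κ₁ κ₂ γ₁ γ₂ c1 c2 hp hgood c9 c16 c10 hodd hne3 c15 hirr c11 c12 c13 c14 c20 c21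
      Ω δ Ωp LK G hΩ hδ hLK hG,
    h ι W' K v vbar κ₁ κ₂ γ₁ γ₂ c3 c4 hp hgood' c9 hHeeg' c10 hodd hne3 hND' hirr' c11 c12 c13 c14 c20 c21
      Ω δ Ωp LK G' hΩ hδ hLK hG'⟩

/-! ## §3. (S3) the s-free Greenberg → signed transfer and descent for the twist pair — WITHOUT `Surj` -/

open Summit.BirchSwinnertonDyer.BirchSwinnertonDyer.Theorems.SignedBaseChangeK2RTransferDescent in
/-- **(S3) of K2R⁗ without `Surj`.** VERBATIM the tree's
`…K2RTransferDescent.productLowerDivisibility_of_package` (granted the BSTW two-variable signed package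
`props118_27_519_…_PRE` BY NAME: for the package data, a genuine common frame, a structure map `J`, the s-free
product inclusion and «`γ₁` canonical», the four-curve signed lower divisibility
`L^ε(f)·L^ε(f₂)·L^ε(f')·L^ε(f₄) ∣ g₁·g₂·g₃·g₄` in `ℤ_p⟦T⟧`) with the binder `Surj W p →` DELETED: its one use —
absolute irreducibility of every framing of `W'_K[p]` (the package's image clause at `f'`) — is re-sourced from
Serre Prop. 12 + Matar–Nekovář Prop. 5.26 (2)(3) (`SmallImageIrrK.isAbsolutelyIrreducible_baseChange_of_goodSS_of_split`,
`p` split in `K` = clause c10, `(N', D_K) = 1`). CONDITIONAL on the PRE binder; nothing of BSTW is asserted.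
[cite: BurungaleSkinnerTianWan2024, §2.3 proof of Thm. (KoMC_r) (arXiv v2 TeX store p0076 L36–L65), with Prop. 1.18 (p0072), Prop. 2.7 (p0076 L20–33), Prop. 5.19 (p0054–55) (ANNOUNCED; taken as the OPEN binder `props118_27_519_…_PRE`)]
[cite: MatarNekovar2019, Prop. 5.26 (2) and (3) (p. 492)] [cite: Kobayashi2003, Thm. 3.2 and (3.4)–(3.6) (p. 7)] -/
theorem productLowerDivisibility_of_package_noSurj
    (hpkg : props118_27_519_exists_signedTwoVariablePackage_supersingular_PRE) :
    ∀ (W : WeierstrassCurve ℚ) [W.IsElliptic] [W.IsGloballyMinimal] (p : ℕ) [Fact p.Prime], 5 ≤ p →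
    ClassX7 W p →
    ∀ (K : Type) [Field K] [NumberField K] (ι : PadicAlgCl p ≃+* ℂ) (v vbar : IsDedekindDomain.HeightOneSpectrum (NumberField.RingOfIntegers K)) (κ₁ κ₂ : Literature.NumberTheory.EllipticCurves.ZpExtension K p) (γ₁ γ₂ : Field.absoluteGaloisGroup K) [Fact (Literature.NumberTheory.EllipticCurves.ZpExtension.IsTopGeneratorPair κ₁ κ₂ γ₁ γ₂)] [NeZero (NumberField.discr K).natAbs] (N : ℕ) [NeZero N] (f : CuspForm (CongruenceSubgroup.Gamma0 N) 2) (d : ℤ) (W' : WeierstrassCurve ℚ) [W'.IsElliptic] [W'.IsGloballyMinimal] (C : WeierstrassCurve.VariableChange ℚ) (N' : ℕ) [NeZero N'] (f' : CuspForm (CongruenceSubgroup.Gamma0 N') 2),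
    (Literature.NumberTheory.EllipticCurves.ModularForms.IsNewformOf W f) →
    ((N : ℤ) = W.conductorNorm ℤ) →
    (Literature.NumberTheory.EllipticCurves.ModularForms.IsNewformOf W' f') →
    ((N' : ℤ) = W'.conductorNorm ℤ) →
    (Squarefree d) →
    (1 < d) →
    (∀ q : ℕ, q.Prime → Literature.NumberTheory.EllipticCurves.BurungaleSkinnerTianWan2024.RamifiedInQuadratic d q → q ≠ p ∧ ¬ q ∣ N ∧ ¬ (q : ℤ) ∣ NumberField.discr K) →
    (C • W' = W.quadraticTwist (d : ℚ)) →
    (Literature.NumberTheory.EllipticCurves.IsImaginaryQuadratic K) →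
    (((Ideal.span {(p : ℤ)}).primesOver (NumberField.RingOfIntegers K)).ncard = 2) →
    (((p : ℕ) : NumberField.RingOfIntegers K) ∈ v.asIdeal) →
    (((p : ℕ) : NumberField.RingOfIntegers K) ∈ vbar.asIdeal) →
    (vbar ≠ v) →
    (∀ (w : NumberField.InfinitePlace K) (k : NumberField.RingOfIntegers K), k ∈ v.asIdeal ↔ ‖ι.symm (w.embedding (k : K))‖ < 1) →
    (IsCoprime (N : ℤ) (NumberField.discr K)) →
    (∀ ℓ : ℕ, ℓ.Prime → ℓ ∣ N → ((Ideal.span {(ℓ : ℤ)}).primesOver (NumberField.RingOfIntegers K)).ncard = 2) →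
    (∀ ℓ : ℕ, ℓ.Prime → (ℓ : ℤ) ∣ d → ((Ideal.span {(ℓ : ℤ)}).primesOver (NumberField.RingOfIntegers K)).ncard = 2) →
    (((Ideal.span {(2 : ℤ)}).primesOver (NumberField.RingOfIntegers K)).ncard = 2) →
    (∀ ρ : Literature.NumberTheory.GaloisRepresentations.ModPGaloisRep K (ZMod p) 2, (W.baseChange K).IsTorsionGaloisRep p ρ → Literature.NumberTheory.GaloisRepresentations.FramedRep.IsAbsolutelyIrreducible ρ) →
    (κ₁.IsCyclotomic) →
    (κ₂.IsAnticyclotomic) →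
    ∀ (Ω δ : ℂ) (Ωp : (Literature.NumberTheory.EllipticCurves.unrIntegers p)ˣ)
      (LK G G' : PowerSeries (PowerSeries (PadicComplexInt p))),
      Ω ≠ 0 → (δ ^ 2 = (NumberField.discr K : ℂ) ∨ δ ^ 2 = -(NumberField.discr K : ℂ)) →
      Literature.NumberTheory.EllipticCurves.IsKatzMeasure₂ ι v vbar ∅ κ₁ κ₂ γ₁⁻¹ γ₂⁻¹ 1 Ω δ
        ((Ωp : Literature.NumberTheory.EllipticCurves.unrIntegers p) : PadicComplex p) LK →
      Literature.NumberTheory.EllipticCurves.IsGreenbergLFunctionAnyRoot₂ ι v vbar κ₁ κ₂ γ₁⁻¹ γ₂⁻¹ f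
        (NumberField.discr K).natAbs (NumberField.classNumber K) LK G →
      Literature.NumberTheory.EllipticCurves.IsGreenbergLFunctionAnyRoot₂ ι v vbar κ₁ κ₂ γ₁⁻¹ γ₂⁻¹ f'
        (NumberField.discr K).natAbs (NumberField.classNumber K) LK G' →
    ∀ J : ℤ_[p] →+* PadicComplexInt p,
      (∀ x : ℤ_[p], ((J x : PadicComplexInt p) : PadicComplex p) = ((x : ℚ_[p]) : PadicComplex p)) →
      (WeierstrassCurve.XGr₂.charIdeal (W.baseChange K) p κ₁ κ₂ vbar γ₁ γ₂).map
          (Literature.NumberTheory.EllipticCurves.IwasawaAlgebra₂.toUnr₂ p J) *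
        (WeierstrassCurve.XGr₂.charIdeal (W'.baseChange K) p κ₁ κ₂ vbar γ₁ γ₂).map
          (Literature.NumberTheory.EllipticCurves.IwasawaAlgebra₂.toUnr₂ p J) ≤ Ideal.span {G * G'} →
    -- «γ₁ canonical» (NOT in the package as filed)
    (∃ ζ : ℤ_[p]ˣ, IsOfFinOrder ζ ∧
      ((GaloisRep.cyclotomicCharacter K p γ₁ * ζ : ℤ_[p]ˣ) : ℤ_[p]) = (cyclotomicGenerator p : ℤ_[p])) →
    ∀ (W₂ W₄ : WeierstrassCurve ℚ) [W₂.IsElliptic] [W₂.IsGloballyMinimal] [W₄.IsElliptic] [W₄.IsGloballyMinimal]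
      (C₂ C₄ : WeierstrassCurve.VariableChange ℚ),
      C₂ • W₂ = W.quadraticTwist (NumberField.discr K : ℚ) → C₄ • W₄ = W'.quadraticTwist (NumberField.discr K : ℚ) →
    ∀ ε : ℤˣ, ∀ (κ : ZpExtension ℚ p) (γ : Field.absoluteGaloisGroup ℚ),
      κ.IsCyclotomic → κ.IsTopGenerator γ → IsCyclotomicVariable p γ →
      ∀ (Lp₁ Lm₁ : IwasawaAlgebra p), IsPollackPair f p Lp₁ Lm₁ →
      ∀ (D₁ : SignedSelmerDualData W κ γ ε) (g₁ : IwasawaAlgebra p), D₁.charIdeal = Ideal.span {g₁} →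
      ∀ {N₂ : ℕ} [NeZero N₂] (f₂ : CuspForm (Gamma0 N₂) 2), IsNewformOf W₂ f₂ →
      ∀ (Lp₂ Lm₂ : IwasawaAlgebra p), IsPollackPair f₂ p Lp₂ Lm₂ →
      ∀ (D₂ : SignedSelmerDualData W₂ κ γ ε) (g₂ : IwasawaAlgebra p), D₂.charIdeal = Ideal.span {g₂} →
      ∀ (Lp₃ Lm₃ : IwasawaAlgebra p), IsPollackPair f' p Lp₃ Lm₃ →
      ∀ (D₃ : SignedSelmerDualData W' κ γ ε) (g₃ : IwasawaAlgebra p), D₃.charIdeal = Ideal.span {g₃} →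
      ∀ {N₄ : ℕ} [NeZero N₄] (f₄ : CuspForm (Gamma0 N₄) 2), IsNewformOf W₄ f₄ →
      ∀ (Lp₄ Lm₄ : IwasawaAlgebra p), IsPollackPair f₄ p Lp₄ Lm₄ →
      ∀ (D₄ : SignedSelmerDualData W₄ κ γ ε) (g₄ : IwasawaAlgebra p), D₄.charIdeal = Ideal.span {g₄} →
      kobayashiL ε Lp₁ Lm₁ * kobayashiL ε Lp₂ Lm₂ * kobayashiL ε Lp₃ Lm₃ * kobayashiL ε Lp₄ Lm₄ ∣
        g₁ * g₂ * g₃ * g₄ := by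
  intro W _ _ p _ hp5 hX K _ _ ι v vbar κ₁ κ₂ γ₁ γ₂ hpair _ N _ f d W' _ _ C N' _ f'
    c1 c2 c3 c4 c5 c6 c7 c8 c9 c10 c11 c12 c13 c14 c15 c16 c17 c18 c19 c20 c21
    Ω δ Ωp LK G G' hΩ hδ hLK hG hG' J hJ hfree hcan W₂ W₄ _ _ _ _ C₂ C₄ hC₂ hC₄ ε κ γ hκ hγ hγ'
    Lp₁ Lm₁ hPP₁ D₁ g₁ hg₁ N₂ _ f₂ hf₂ Lp₂ Lm₂ hPP₂ D₂ g₂ hg₂ Lp₃ Lm₃ hPP₃ D₃ g₃ hg₃ N₄ _ f₄ hf₄ Lp₄ Lm₄ hPP₄ D₄ g₄ hg₄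
  -- basics at `p` for `W` and for the twist `W'`
  have hpP : p.Prime := Fact.out
  have hp2 : p ≠ 2 := by omega
  have hgood : W.HasGoodReductionAtPrime p := hX.1.1
  have hap : W.frobeniusTrace p = 0 := ClassX7.frobeniusTrace_eq_zero_of_five_le W p hp5 hX
  have hpN : ¬ (p : ℤ) ∣ W.conductorNorm ℤ := fun h ↦
    (W.dvd_conductorNorm_iff_not_hasGoodReductionAtPrime p).mp (by exact_mod_cast h) hgood
  have hpd : ¬ (p : ℤ) ∣ d := fun h ↦ (c7 p hpP (Or.inl h)).1 rfl
  have hp2d : ¬ (p : ℤ) ∣ 2 * d := by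
    intro h
    rcases (Nat.prime_iff_prime_int.mp hpP).dvd_or_dvd h with h2 | hd'
    · have : p ∣ 2 := by exact_mod_cast h2
      exact hp2 ((Nat.prime_dvd_prime_iff_eq hpP Nat.prime_two).mp this)
    · exact hpd hd'
  have hgood' : W'.HasGoodReductionAtPrime p := hasGoodReductionAtPrime_of_smul_eq_quadraticTwist W W' p c8 hp2d hgood
  have hap' : W'.frobeniusTrace p = 0 := by
    rw [frobeniusTrace_of_smul_eq_quadraticTwist W W' p c5 c8 hp2d hgood, hap, mul_zero]
  have hpN' : ¬ (p : ℤ) ∣ W'.conductorNorm ℤ := fun h ↦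
    (W'.dvd_conductorNorm_iff_not_hasGoodReductionAtPrime p).mp (by exact_mod_cast h) hgood'
  have hND' : IsCoprime (N' : ℤ) (NumberField.discr K) :=
    Summit.BirchSwinnertonDyer.BirchSwinnertonDyer.Theorems.SignedBaseChangeK2RTransferDescent.isCoprime_conductorNorm_twist_discr
      W W' c8 c2 c4 K c9.1 (fun q hq hr ↦ (c7 q hq hr).2.2) c18 c15
  -- abs-irr of every framing of `W'_K[p]`: Serre Prop. 12 + Matar–Nekovář Prop. 5.26 (2)(3) — NO `Surj`
  have hirr' : ∀ ρ : ModPGaloisRep K (ZMod p) 2, (W'.baseChange K).IsTorsionGaloisRep p ρ →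
      FramedRep.IsAbsolutelyIrreducible ρ := fun ρ hρ ↦
    SmallImageIrrK.isAbsolutelyIrreducible_baseChange_of_goodSS_of_split W' p hp2 hgood' (hap' ▸ dvd_zero _)
      K c9.1 c4 hND' c10 ρ hρ
  -- the package at `(f, G)` and at `(f', G')`
  obtain ⟨xi, Ls, hP1, hline⟩ := hpkg ι W K v vbar κ₁ κ₂ γ₁ γ₂ f c1 c2 hp2 hpN hap c9 c10 c11 c12 c13 c14
    c15 c19 c20 c21 Ω δ Ωp LK G hΩ hδ hLK hG J hJ ε
  obtain ⟨xi', Ls', hP1', hline'⟩ := hpkg ι W' K v vbar κ₁ κ₂ γ₁ γ₂ f' c3 c4 hp2 hpN' hap' c9 c10 c11 c12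
    c13 c14 hND' hirr' c20 c21 Ω δ Ωp LK G' hΩ hδ hLK hG' J hJ ε
  -- the cyclotomic-line clauses for `(W, W₂)` and for `(W', W₄)`
  have hcoord := exists_isOfFinOrder_mul_eq_of_canonical hcan hγ'
  obtain ⟨hP2, hP3⟩ := hline κ γ hκ hγ hγ' hcoord W₂ C₂ hC₂
  obtain ⟨hP2', hP3'⟩ := hline' κ γ hκ hγ hγ' hcoord W₄ C₄ hC₄
  -- Kobayashi's `L^ε` out of the Pollack pairs
  have hL₁ : IsSignedPAdicLFunction f p ε (kobayashiL ε Lp₁ Lm₁) := hPP₁.isSignedPAdicLFunction_kobayashiL ε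
  have hL₂ : IsSignedPAdicLFunction f₂ p ε (kobayashiL ε Lp₂ Lm₂) := hPP₂.isSignedPAdicLFunction_kobayashiL ε
  have hL₃ : IsSignedPAdicLFunction f' p ε (kobayashiL ε Lp₃ Lm₃) := hPP₃.isSignedPAdicLFunction_kobayashiL ε
  have hL₄ : IsSignedPAdicLFunction f₄ p ε (kobayashiL ε Lp₄ Lm₄) := hPP₄.isSignedPAdicLFunction_kobayashiL ε
  have h2 := hP2 D₁ D₂ g₁ g₂ hg₁ hg₂
  obtain ⟨u, hu, h3⟩ := hP3 f₂ hf₂ _ _ hL₁ hL₂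
  have h2' := hP2' D₃ D₄ g₃ g₄ hg₃ hg₄
  obtain ⟨u', hu', h3'⟩ := hP3' f₄ hf₄ _ _ hL₃ hL₄
  -- `𝓛^∘ ≠ 0`, `𝓛'^∘ ≠ 0` (their cyclotomic images are units times Pollack's non-zero functions), hence `G G' ≠ 0`
  have hJinj : Function.Injective J := structureMap_injective hJ
  have hLL : ∀ {L L' : IwasawaAlgebra p}, L ≠ 0 → L' ≠ 0 → PowerSeries.map J (L * L') ≠ 0 :=
    fun hL hL' ↦ map_structureMap_ne_zero hJ (mul_ne_zero hL hL')
  have hLs : Ls ≠ 0 := by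
    intro h0
    have h := h3
    rw [h0] at h
    have : PowerSeries.map J (kobayashiL ε Lp₁ Lm₁ * kobayashiL ε Lp₂ Lm₂) = 0 := by
      have h' : u * PowerSeries.map J (kobayashiL ε Lp₁ Lm₁ * kobayashiL ε Lp₂ Lm₂) = 0 := by
        rw [← h]; simp [UnrSeries₂.plus]
      exact (hu.mul_right_eq_zero).mp h'
    exact hLL
      (Summit.BirchSwinnertonDyer.BirchSwinnertonDyer.Theorems.SignedBaseChangeEisensteinSqueeze.kobayashiL_ne_zero hPP₁ ε)
      (Summit.BirchSwinnertonDyer.BirchSwinnertonDyer.Theorems.SignedBaseChangeEisensteinSqueeze.kobayashiL_ne_zero hPP₂ ε) this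
  have hLs' : Ls' ≠ 0 := by
    intro h0
    have h := h3'
    rw [h0] at h
    have : PowerSeries.map J (kobayashiL ε Lp₃ Lm₃ * kobayashiL ε Lp₄ Lm₄) = 0 := by
      have h' : u' * PowerSeries.map J (kobayashiL ε Lp₃ Lm₃ * kobayashiL ε Lp₄ Lm₄) = 0 := by
        rw [← h]; simp [UnrSeries₂.plus]
      exact (hu'.mul_right_eq_zero).mp h'
    exact hLL
      (Summit.BirchSwinnertonDyer.BirchSwinnertonDyer.Theorems.SignedBaseChangeEisensteinSqueeze.kobayashiL_ne_zero hPP₃ ε)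
      (Summit.BirchSwinnertonDyer.BirchSwinnertonDyer.Theorems.SignedBaseChangeEisensteinSqueeze.kobayashiL_ne_zero hPP₄ ε) this
  have hG0 : G ≠ 0 := ne_zero_of_span_mul_eq hP1 (map_charIdealXGr₂_ne_bot _ κ₁ κ₂ vbar γ₁ γ₂ hJinj) hLs
  have hG0' : G' ≠ 0 := ne_zero_of_span_mul_eq hP1' (map_charIdealXGr₂_ne_bot _ κ₁ κ₂ vbar γ₁ γ₂ hJinj) hLs'
  have hGG' : G * G' ≠ 0 := mul_ne_zero hG0 hG0'
  -- cancel the Greenberg functions (P1 ×2 + the s-free product inclusion): `𝓛^∘ 𝓛'^∘ ∣ ξ_∘ ξ'_∘`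
  have hdvd : Ls * Ls' ∣ xi * xi' := mul_dvd_mul_of_span_mul_eq_of_le_span hP1 hP1' hfree hGG'
  -- descend through `plus` = "mod (γ_ac − 1)" with (P2), (P3)
  have hS : PowerSeries.map J (kobayashiL ε Lp₁ Lm₁ * kobayashiL ε Lp₂ Lm₂) *
      PowerSeries.map J (kobayashiL ε Lp₃ Lm₃ * kobayashiL ε Lp₄ Lm₄) ∣
      PowerSeries.map J (g₁ * g₂) * PowerSeries.map J (g₃ * g₄) :=
    mul_dvd_mul_of_map_of_dvd_of_eq_unit_mul
      (PowerSeries.map (PowerSeries.constantCoeff (R := PadicComplexInt p))) hdvd h2 h2' hu hu' h3 h3'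
  -- descend to `ℤ_p⟦T⟧`
  rw [← map_mul, ← map_mul] at hS
  have hZ := Summit.BirchSwinnertonDyer.BirchSwinnertonDyer.Theorems.SignedBaseChangeK2RDivisibilityDescent.iwasawaAlgebra_dvd_of_map_dvd_map_padicComplexInt
    hJ hS
  have e1 : kobayashiL ε Lp₁ Lm₁ * kobayashiL ε Lp₂ Lm₂ * kobayashiL ε Lp₃ Lm₃ * kobayashiL ε Lp₄ Lm₄ =
      kobayashiL ε Lp₁ Lm₁ * kobayashiL ε Lp₂ Lm₂ * (kobayashiL ε Lp₃ Lm₃ * kobayashiL ε Lp₄ Lm₄) := by ring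
  have e2 : g₁ * g₂ * g₃ * g₄ = g₁ * g₂ * (g₃ * g₄) := by ring
  rw [e1, e2]
  exact hZ


end Summit.BirchSwinnertonDyer.BirchSwinnertonDyer.Theorems.SmallImageTwoVariableInputsNoSurj

end
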